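import Mathlib
import Summits.MatrixMultiplication.MatrixMultiplication.Theorems.LevelGradedCohnUmansLevelOneGL2DesignsQuadraticLift
import Summits.MatrixMultiplication.MatrixMultiplication.Theorems.LevelGradedCohnUmansLevelOneGL2DesignsQuadraticLiftDigits

/-!
# Strong representative systems of `AG(2,p)` of size `≫ p^{5/4}` for every prime `p`
(wall-breaker k8 for `stub_tangencySets`, crux `LevelOneGL2Designs`, stmt-MatrixMultiplication-14080)

Assembly of the quadratic-order parabola lift (`…QuadraticLift.lean`) with the inert-prime digit
sets (`…QuadraticLiftDigits.lean`):

* `srs_of_sqDiffFree_box` — one scale: `φ : ℤ√d →+* 𝔽_p` with `|d| ≤ 2`, the box `[0,m)²` and a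
  square-difference-free `K ⊆ [0,m²)²` of `ℤ√d` give an SRS with `≥ m²|K| - 2|K|` flags once
  `34·m⁴ < p`.
* `exists_card_ge_rpow` — bookkeeping: if at every scale `t` with `34·b^{4t} < p` there is an
  admissible family with `≥ b^{5t} - 2b^{3t}` members (and some admissible family is non-empty), then
  there is one with `≥ c_b·p^{5/4}` members, `c_b = 1/(2·(68 b⁴)^{5/4})`.
* `exists_srs_card_ge_rpow_of_isSquare_two / _neg_two / _neg_one` — for every prime `p` with
  `2` (resp. `-2`, `-1`) a square mod `p`, an SRS of `AG(2,p)` with `≥ c·p^{5/4}` flags, from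
  `ℤ[√2]` base `3` (resp. `ℤ[√-2]` base `5`, `ℤ[√-1]` base `3`).
* `exists_srs_card_ge_rpow_five_fourths` — **for EVERY prime `p` an SRS of `AG(2,p)` (an induced
  matching of the point–line incidence graph of `𝔽_p²`) with at least `c·p^{5/4}` flags**, `c > 0`
  absolute: `p ≡ ±1 (8)` via `√2`, `p ≡ 3 (8)` via `√-2`, `p ≡ 5 (8)` via `√-1`, `p = 2` trivially.
  In the notation of Hunter–Pohoata–Verstraëte–Zhang (arXiv:2601.19879): `IM(2,p) ≫ p^{1.25}`,
  improving their Theorem 1.2 (`p^{1.2334}`, in this tree `ParabolaLift.exists_srs_card_ge_rpow` at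
  `37/30`); the Gaussian branch is also wall-breaker k2's `…GaussLift…`.
* `tangencySets_exponent_five_fourths` — the same in the quantifier shape of `stub_tangencySets`
  (which asks for exponent `3/2`; the axis cannot deliver that — square-difference-free sets in any
  order have density `o(1)` by the multidimensional Furstenberg–Sárközy theorem — see AXIS.md).

References: Hunter–Pohoata–Verstraëte–Zhang 2026 [bib: HunterPohoataVerstraeteZhang2026];
Ruzsa 1984 [bib: Ruzsa1984DifferenceSetsWithoutSquares].  Elementary; no definitions.
-/

-- justification: the summit/problem path `MatrixMultiplication.MatrixMultiplication` is fixed by the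
-- tree layout (D-0017), so the namespace necessarily repeats a component.
set_option linter.dupNamespace false

open Matrix Finset

namespace Summit.MatrixMultiplication.MatrixMultiplication.Theorems.LevelOneGL2Designs.QuadraticLift

section Scale

variable {d : ℤ} {p : ℕ} [Fact p.Prime]

/-- **One scale of the quadratic lift.**  For `|d| ≤ 2`, `φ : ℤ√d →+* 𝔽_p`, and a
square-difference-free `K ⊆ [0,L)²` of `ℤ√d` with `L = m²` and `34·L² < p`, the box `[0,m)²` lifts with
`K` to a strong representative system of `AG(2,p)` with at least `L·|K| - 2|K|` flags. [elementary] -/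
theorem srs_of_sqDiffFree_box (hd : ∀ n : ℤ, d ≠ n * n) (hd2 : |d| ≤ 2) (φ : ℤ√d →+* ZMod p)
    (m L : ℕ) (hmL : m * m = L) (K : Finset (ℤ√d))
    (hKbox : ∀ k ∈ K, 0 ≤ k.re ∧ k.re < L ∧ 0 ≤ k.im ∧ k.im < L)
    (hK : ∀ k ∈ K, ∀ k' ∈ K, ∀ z : ℤ√d, k - k' = z * z → z = 0) (hp : 34 * L ^ 2 < p) :
    ∃ S : Finset ((Fin 2 → ZMod p) × (Fin 2 → ZMod p)), L * K.card ≤ S.card + 2 * K.card ∧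
      ∀ f ∈ S, ∀ f' ∈ S, (dotProduct f.1 f'.2 = 1 ↔ f = f') := by
  obtain ⟨X, hXcard, hX⟩ := exists_box d m
  have hmL' : ((m : ℤ)) ^ 2 = L := by rw [sq]; exact_mod_cast hmL
  have hp' : 34 * (L : ℤ) ^ 2 < p := by exact_mod_cast hp
  have hB : ((1 + |d|) * (m : ℤ) ^ 2 + L) ^ 2 + |d| * (2 * (m : ℤ) ^ 2 + L) ^ 2 < p := by
    rw [hmL']
    have h0 : 0 ≤ |d| := abs_nonneg d
    have key : 34 * (L : ℤ) ^ 2 - (((1 + |d|) * L + L) ^ 2 + |d| * (2 * L + L) ^ 2)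
        = (2 - |d|) * (15 + |d|) * (L : ℤ) ^ 2 := by ring
    have hnn : 0 ≤ (2 - |d|) * (15 + |d|) * (L : ℤ) ^ 2 := by
      have : 0 ≤ 2 - |d| := by linarith
      positivity
    linarith
  obtain ⟨S, hS, hsrs⟩ := quadLift_box_srs hd φ m L X K hX hKbox hK hB
  refine ⟨S, ?_, hsrs⟩
  rwa [hXcard, hmL] at hS

/-- A single flag is a strong representative system (used for small primes). [elementary] -/
theorem exists_srs_card_one :
    ∃ S : Finset ((Fin 2 → ZMod p) × (Fin 2 → ZMod p)), 1 ≤ S.card ∧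
      ∀ f ∈ S, ∀ f' ∈ S, (dotProduct f.1 f'.2 = 1 ↔ f = f') := by
  refine ⟨{(![1, 0], ![1, 0])}, by simp, ?_⟩
  intro f hf f' hf'
  rw [mem_singleton] at hf hf'
  subst hf hf'
  simp

end Scale

section Bookkeeping

/-- **Scale bookkeeping.**  Let `b ≥ 2` and `P` a property of finite families.  If some family with
`P` is non-empty, and for every `t` with `34·b^{4t} < p` there is a family with `P` and at least
`b^{5t} - 2·b^{3t}` members, then there is a family with `P` and at least `c_b·p^{5/4}` members,
`c_b = 1/(2(68b⁴)^{5/4})`: take the largest such `t`; then `p < 68·b⁴·b^{4t}` and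
`b^{5t} = (b^{4t})^{5/4}`. [elementary] -/
theorem exists_card_ge_rpow {α : Type*} (P : Finset α → Prop) (b : ℕ) (hb : 2 ≤ b) (p : ℕ)
    (h1 : ∃ S : Finset α, 1 ≤ S.card ∧ P S)
    (h : ∀ t : ℕ, 34 * b ^ (4 * t) < p →
      ∃ S : Finset α, b ^ (5 * t) ≤ S.card + 2 * b ^ (3 * t) ∧ P S) :
    ∃ S : Finset α, 1 / (2 * (68 * (b : ℝ) ^ 4) ^ (5 / 4 : ℝ)) * (p : ℝ) ^ (5 / 4 : ℝ) ≤ S.card ∧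
      P S := by
  obtain ⟨S₁, hS₁, hP₁⟩ := h1
  have hbpos : (0 : ℝ) < b := by exact_mod_cast (show 0 < b by omega)
  have h68 : (0 : ℝ) < 68 * (b : ℝ) ^ 4 := by positivity
  by_cases hp : p ≤ 68 * b ^ 4
  · -- small `p`: one member suffices
    refine ⟨S₁, ?_, hP₁⟩
    have h1' : (1 : ℝ) ≤ S₁.card := by exact_mod_cast hS₁
    have hp' : (p : ℝ) ≤ 68 * (b : ℝ) ^ 4 := by exact_mod_cast hp
    have hmono : (p : ℝ) ^ (5 / 4 : ℝ) ≤ (68 * (b : ℝ) ^ 4) ^ (5 / 4 : ℝ) :=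
      Real.rpow_le_rpow (by positivity) hp' (by norm_num)
    have hpow : (0 : ℝ) < (68 * (b : ℝ) ^ 4) ^ (5 / 4 : ℝ) := by positivity
    calc 1 / (2 * (68 * (b : ℝ) ^ 4) ^ (5 / 4 : ℝ)) * (p : ℝ) ^ (5 / 4 : ℝ)
        ≤ 1 / (2 * (68 * (b : ℝ) ^ 4) ^ (5 / 4 : ℝ)) * (68 * (b : ℝ) ^ 4) ^ (5 / 4 : ℝ) := by
          gcongr
      _ = 1 / 2 := by field_simp
      _ ≤ S₁.card := by linarith
  · rw [not_le] at hp
    -- the scale `t`: largest with `(b⁴)^t ≤ p / 68`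
    set B : ℕ := b ^ 4 with hB
    set n : ℕ := p / 68 with hn
    have hB16 : 16 ≤ B := by
      have : 2 ^ 4 ≤ b ^ 4 := Nat.pow_le_pow_left hb 4
      simpa [hB] using this
    have hB1 : 1 < B := by omega
    have hnB : B ≤ n := by
      rw [hn, Nat.le_div_iff_mul_le (by norm_num)]
      omega
    have hn0 : n ≠ 0 := by omega
    set t : ℕ := Nat.log B n with ht
    have ht1 : B ^ t ≤ n := Nat.pow_log_le_self B hn0
    have ht2 : n < B ^ (t + 1) := Nat.lt_pow_succ_log_self hB1 n
    have htpos : 0 < t := Nat.log_pos hB1 hnB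
    have hBt : b ^ (4 * t) = B ^ t := by rw [pow_mul]
    -- (i) the scale is admissible
    have hi : 34 * b ^ (4 * t) < p := by
      rw [hBt]
      have : 68 * (p / 68) ≤ p := Nat.mul_div_le p 68
      omega
    obtain ⟨S, hS, hPS⟩ := h t hi
    refine ⟨S, ?_, hPS⟩
    -- (ii) `p < 68 · B · B^t`
    have hii : p < 68 * B * B ^ t := by
      have h3 : p < 68 * (n + 1) := by omega
      calc p < 68 * (n + 1) := h3
        _ ≤ 68 * B ^ (t + 1) := by gcongr; exact ht2
        _ = 68 * B * B ^ t := by rw [pow_succ]; ring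
    -- real estimates
    have hbt_ge : (p : ℝ) / (68 * (b : ℝ) ^ 4) ≤ (b : ℝ) ^ (4 * t) := by
      rw [div_le_iff₀ h68]
      have h' : (p : ℝ) < ((68 * B * B ^ t : ℕ) : ℝ) := by exact_mod_cast hii
      rw [hB] at h'
      push_cast at h'
      rw [← pow_mul] at h'
      linarith
    have h54 : ((b : ℝ) ^ (4 * t)) ^ (5 / 4 : ℝ) = (b : ℝ) ^ (5 * t) := by
      rw [← Real.rpow_natCast, ← Real.rpow_natCast, ← Real.rpow_mul hbpos.le]
      congr 1
      push_cast
      ring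
    have hmain : (p : ℝ) ^ (5 / 4 : ℝ) / (68 * (b : ℝ) ^ 4) ^ (5 / 4 : ℝ) ≤ (b : ℝ) ^ (5 * t) := by
      rw [← Real.div_rpow (by positivity) h68.le, ← h54]
      exact Real.rpow_le_rpow (by positivity) hbt_ge (by norm_num)
    -- `|S| ≥ b^{5t} - 2 b^{3t} ≥ b^{5t} / 2`
    have hgap : 4 * b ^ (3 * t) ≤ b ^ (5 * t) := by
      have h4 : 4 ≤ b ^ (2 * t) :=
        calc 4 = 2 ^ 2 := by norm_num
          _ ≤ b ^ 2 := Nat.pow_le_pow_left hb 2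
          _ ≤ b ^ (2 * t) := Nat.pow_le_pow_right (by omega) (by omega)
      calc 4 * b ^ (3 * t) ≤ b ^ (2 * t) * b ^ (3 * t) := Nat.mul_le_mul_right _ h4
        _ = b ^ (5 * t) := by rw [← pow_add]; ring_nf
    have hS' : ((b : ℝ)) ^ (5 * t) ≤ S.card + 2 * (b : ℝ) ^ (3 * t) := by exact_mod_cast hS
    have hgap' : 4 * (b : ℝ) ^ (3 * t) ≤ (b : ℝ) ^ (5 * t) := by exact_mod_cast hgap
    have hpow : (0 : ℝ) < (68 * (b : ℝ) ^ 4) ^ (5 / 4 : ℝ) := by positivity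
    calc 1 / (2 * (68 * (b : ℝ) ^ 4) ^ (5 / 4 : ℝ)) * (p : ℝ) ^ (5 / 4 : ℝ)
        = ((p : ℝ) ^ (5 / 4 : ℝ) / (68 * (b : ℝ) ^ 4) ^ (5 / 4 : ℝ)) / 2 := by
          field_simp
      _ ≤ (b : ℝ) ^ (5 * t) / 2 := by gcongr
      _ ≤ S.card := by linarith

end Bookkeeping

section Assembly

/-- **`√2` branch (`p ≡ ±1 mod 8`).**  For every prime `p` with `2` a square mod `p` there is a strong
representative system of `AG(2,p)` with at least `c·p^{5/4}` flags: the `ℤ[√2]` lift of the base-`3`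
digit sets. [elementary] -/
theorem exists_srs_card_ge_rpow_of_isSquare_two :
    ∃ c : ℝ, 0 < c ∧ ∀ (p : ℕ) [Fact p.Prime], IsSquare (2 : ZMod p) →
      ∃ S : Finset ((Fin 2 → ZMod p) × (Fin 2 → ZMod p)),
        c * (p : ℝ) ^ (5 / 4 : ℝ) ≤ S.card ∧
        ∀ f ∈ S, ∀ f' ∈ S, (dotProduct f.1 f'.2 = 1 ↔ f = f') := by
  refine ⟨1 / (2 * (68 * ((3 : ℕ) : ℝ) ^ 4) ^ (5 / 4 : ℝ)), by positivity, ?_⟩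
  intro p _ h2
  obtain ⟨s, hs⟩ := h2
  let φ : ℤ√2 →+* ZMod p := Zsqrtd.lift ⟨s, by rw [← hs]; norm_num⟩
  refine exists_card_ge_rpow _ 3 (by norm_num) p exists_srs_card_one fun t ht => ?_
  obtain ⟨K, hKcard, hKbox, hK⟩ := exists_sqDiffFree_sqrtTwo t
  have h9 : 3 ^ t * 3 ^ t = 9 ^ t := by rw [← mul_pow]; norm_num
  have hp : 34 * (9 ^ t) ^ 2 < p := by
    have h81 : (9 ^ t) ^ 2 = 81 ^ t := by rw [← pow_mul, mul_comm, pow_mul]; norm_num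
    have h81' : 3 ^ (4 * t) = 81 ^ t := by rw [pow_mul]; norm_num
    rw [h81, ← h81']; exact ht
  obtain ⟨S, hS, hsrs⟩ := srs_of_sqDiffFree_box two_ne_mul_self (by norm_num) φ (3 ^ t) (9 ^ t) h9
    K (fun k hk => by exact_mod_cast hKbox k hk) hK hp
  refine ⟨S, ?_, hsrs⟩
  rw [hKcard] at hS
  have h5 : 3 ^ (5 * t) = 9 ^ t * 27 ^ t := by
    rw [← mul_pow, pow_mul]; norm_num
  have h3 : 3 ^ (3 * t) = 27 ^ t := by rw [pow_mul]; norm_num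
  rw [h5, h3]
  exact hS

/-- **`√-2` branch (`p ≡ 1, 3 mod 8`).**  For every prime `p` with `-2` a square mod `p` there is a
strong representative system of `AG(2,p)` with at least `c·p^{5/4}` flags: the `ℤ[√-2]` lift of the
base-`5` digit sets. [elementary] -/
theorem exists_srs_card_ge_rpow_of_isSquare_neg_two :
    ∃ c : ℝ, 0 < c ∧ ∀ (p : ℕ) [Fact p.Prime], IsSquare (-2 : ZMod p) →
      ∃ S : Finset ((Fin 2 → ZMod p) × (Fin 2 → ZMod p)),
        c * (p : ℝ) ^ (5 / 4 : ℝ) ≤ S.card ∧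
        ∀ f ∈ S, ∀ f' ∈ S, (dotProduct f.1 f'.2 = 1 ↔ f = f') := by
  refine ⟨1 / (2 * (68 * ((5 : ℕ) : ℝ) ^ 4) ^ (5 / 4 : ℝ)), by positivity, ?_⟩
  intro p _ h2
  obtain ⟨s, hs⟩ := h2
  let φ : ℤ√(-2) →+* ZMod p := Zsqrtd.lift ⟨s, by rw [← hs]; norm_num⟩
  refine exists_card_ge_rpow _ 5 (by norm_num) p exists_srs_card_one fun t ht => ?_
  obtain ⟨K, hKcard, hKbox, hK⟩ := exists_sqDiffFree_sqrtNegTwo t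
  have h25 : 5 ^ t * 5 ^ t = 25 ^ t := by rw [← mul_pow]; norm_num
  have hp : 34 * (25 ^ t) ^ 2 < p := by
    have h625 : (25 ^ t) ^ 2 = 625 ^ t := by rw [← pow_mul, mul_comm, pow_mul]; norm_num
    have h625' : 5 ^ (4 * t) = 625 ^ t := by rw [pow_mul]; norm_num
    rw [h625, ← h625']; exact ht
  obtain ⟨S, hS, hsrs⟩ := srs_of_sqDiffFree_box (neg_ne_mul_self (by norm_num)) (by norm_num) φ
    (5 ^ t) (25 ^ t) h25 K (fun k hk => by exact_mod_cast hKbox k hk) hK hp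
  refine ⟨S, ?_, hsrs⟩
  rw [hKcard] at hS
  have h5 : 5 ^ (5 * t) = 25 ^ t * 125 ^ t := by
    rw [← mul_pow, pow_mul]; norm_num
  have h3 : 5 ^ (3 * t) = 125 ^ t := by rw [pow_mul]; norm_num
  rw [h5, h3]
  exact hS

/-- **`√-1` branch (`p ≡ 1 mod 4`; the Gaussian lift, cf. wall-breaker k2's `…GaussLift…`).**  For
every prime `p` with `-1` a square mod `p` there is a strong representative system of `AG(2,p)` with at
least `c·p^{5/4}` flags: the `ℤ[i]` lift of the base-`3` digit sets. [elementary] -/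
theorem exists_srs_card_ge_rpow_of_isSquare_neg_one :
    ∃ c : ℝ, 0 < c ∧ ∀ (p : ℕ) [Fact p.Prime], IsSquare (-1 : ZMod p) →
      ∃ S : Finset ((Fin 2 → ZMod p) × (Fin 2 → ZMod p)),
        c * (p : ℝ) ^ (5 / 4 : ℝ) ≤ S.card ∧
        ∀ f ∈ S, ∀ f' ∈ S, (dotProduct f.1 f'.2 = 1 ↔ f = f') := by
  refine ⟨1 / (2 * (68 * ((3 : ℕ) : ℝ) ^ 4) ^ (5 / 4 : ℝ)), by positivity, ?_⟩
  intro p _ h2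
  obtain ⟨s, hs⟩ := h2
  let φ : ℤ√(-1) →+* ZMod p := Zsqrtd.lift ⟨s, by rw [← hs]; norm_num⟩
  refine exists_card_ge_rpow _ 3 (by norm_num) p exists_srs_card_one fun t ht => ?_
  obtain ⟨K, hKcard, hKbox, hK⟩ := exists_sqDiffFree_sqrtNegOne t
  have h9 : 3 ^ t * 3 ^ t = 9 ^ t := by rw [← mul_pow]; norm_num
  have hp : 34 * (9 ^ t) ^ 2 < p := by
    have h81 : (9 ^ t) ^ 2 = 81 ^ t := by rw [← pow_mul, mul_comm, pow_mul]; norm_num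
    have h81' : 3 ^ (4 * t) = 81 ^ t := by rw [pow_mul]; norm_num
    rw [h81, ← h81']; exact ht
  obtain ⟨S, hS, hsrs⟩ := srs_of_sqDiffFree_box (neg_ne_mul_self (by norm_num)) (by norm_num) φ
    (3 ^ t) (9 ^ t) h9 K (fun k hk => by exact_mod_cast hKbox k hk) hK hp
  refine ⟨S, ?_, hsrs⟩
  rw [hKcard] at hS
  have h5 : 3 ^ (5 * t) = 9 ^ t * 27 ^ t := by
    rw [← mul_pow, pow_mul]; norm_num
  have h3 : 3 ^ (3 * t) = 27 ^ t := by rw [pow_mul]; norm_num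
  rw [h5, h3]
  exact hS

/-- **Strong representative systems of size `≫ p^{5/4}` for EVERY prime** (`IM(2,p) ≫ p^{5/4}`,
improving Hunter–Pohoata–Verstraëte–Zhang 2026, Thm. 1.2, `p^{1.2334}`).  For every prime `p` there is
an SRS of `AG(2,p)` — flags `(x, y)`, line of `y` = `{v : v ⬝ᵥ y = 1}`, `x_i ⬝ᵥ y_j = 1 ↔ i = j` — with
at least `c·p^{5/4}` flags, `c > 0` absolute: `2` is a square mod `p` if `p ≡ ±1 (8)` or `p = 2`, `-2` if
`p ≡ 3 (8)`, `-1` if `p ≡ 5 (8)`. [elementary] -/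
theorem exists_srs_card_ge_rpow_five_fourths :
    ∃ c : ℝ, 0 < c ∧ ∀ p : ℕ, p.Prime →
      ∃ S : Finset ((Fin 2 → ZMod p) × (Fin 2 → ZMod p)),
        c * (p : ℝ) ^ (5 / 4 : ℝ) ≤ S.card ∧
        ∀ f ∈ S, ∀ f' ∈ S, (dotProduct f.1 f'.2 = 1 ↔ f = f') := by
  obtain ⟨c₁, hc₁, h₁⟩ := exists_srs_card_ge_rpow_of_isSquare_two
  obtain ⟨c₂, hc₂, h₂⟩ := exists_srs_card_ge_rpow_of_isSquare_neg_two
  obtain ⟨c₃, hc₃, h₃⟩ := exists_srs_card_ge_rpow_of_isSquare_neg_one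
  refine ⟨min c₁ (min c₂ c₃), lt_min hc₁ (lt_min hc₂ hc₃), fun p hp => ?_⟩
  haveI : Fact p.Prime := ⟨hp⟩
  have hp0 : (0 : ℝ) ≤ (p : ℝ) ^ (5 / 4 : ℝ) := by positivity
  -- which of `2, -2, -1` is a square mod `p`
  rcases eq_or_ne p 2 with rfl | hp2
  · obtain ⟨S, hS, hsrs⟩ := h₁ 2 (FiniteField.isSquare_of_char_two (ZMod.ringChar_zmod_n 2) 2)
    exact ⟨S, le_trans (mul_le_mul_of_nonneg_right (min_le_left _ _) hp0) hS, hsrs⟩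
  have h8 : p % 8 = 1 ∨ p % 8 = 3 ∨ p % 8 = 5 ∨ p % 8 = 7 := by
    have : p % 2 = 1 := Nat.odd_iff.mp (hp.odd_of_ne_two hp2)
    omega
  rcases h8 with h | h | h | h
  · obtain ⟨S, hS, hsrs⟩ := h₁ p ((ZMod.exists_sq_eq_two_iff hp2).mpr (Or.inl h))
    exact ⟨S, le_trans (mul_le_mul_of_nonneg_right (min_le_left _ _) hp0) hS, hsrs⟩
  · obtain ⟨S, hS, hsrs⟩ := h₂ p ((ZMod.exists_sq_eq_neg_two_iff hp2).mpr (Or.inr h))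
    exact ⟨S, le_trans (mul_le_mul_of_nonneg_right
      ((min_le_right _ _).trans (min_le_left _ _)) hp0) hS, hsrs⟩
  · obtain ⟨S, hS, hsrs⟩ := h₃ p (ZMod.exists_sq_eq_neg_one_iff.mpr (by omega))
    exact ⟨S, le_trans (mul_le_mul_of_nonneg_right
      ((min_le_right _ _).trans (min_le_right _ _)) hp0) hS, hsrs⟩
  · obtain ⟨S, hS, hsrs⟩ := h₁ p ((ZMod.exists_sq_eq_two_iff hp2).mpr (Or.inr h))
    exact ⟨S, le_trans (mul_le_mul_of_nonneg_right (min_le_left _ _) hp0) hS, hsrs⟩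

/-- **The stub's quantifier shape at exponent `5/4` (unconditional).**  `stub_tangencySets` with `3/2`
replaced by `5/4`: for every `p₀` there is a prime `p ≥ p₀` (in fact every prime works) carrying a
strong representative system of `AG(2,p)` of size `≥ c·p^{5/4}`; compare
`ParabolaLift.tangencySets_exponent_37_30` (the previous record `37/30 < 5/4`). [elementary] -/
theorem tangencySets_exponent_five_fourths :
    ∃ c : ℝ, 0 < c ∧ ∀ p₀ : ℕ, ∃ (p : ℕ) (_ : Fact p.Prime), p₀ ≤ p ∧
      ∃ S : Finset ((Fin 2 → ZMod p) × (Fin 2 → ZMod p)),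
        c * (p : ℝ) ^ (5 / 4 : ℝ) ≤ S.card ∧
        ∀ f ∈ S, ∀ f' ∈ S, (dotProduct f.1 f'.2 = 1 ↔ f = f') := by
  obtain ⟨c, hc, h⟩ := exists_srs_card_ge_rpow_five_fourths
  refine ⟨c, hc, fun p₀ => ?_⟩
  obtain ⟨p, hp₀, hp⟩ := Nat.exists_infinite_primes p₀
  obtain ⟨S, hS, hsrs⟩ := h p hp
  exact ⟨p, ⟨hp⟩, hp₀, S, hS, hsrs⟩

end Assembly

end Summit.MatrixMultiplication.MatrixMultiplication.Theorems.LevelOneGL2Designs.QuadraticLift
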